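import Summits.Ventures.LatticeQCDFlow.Scaling.DoeblinHotMinorization
import Summits.Ventures.LatticeQCDFlow.Scaling.DominatedStarMixingCeiling

/-!
HONEST FRAMING: exact (Metropolis-corrected) sampling algorithms for lattice gauge theory; figures
of merit are autocorrelation/cost numbers at stated couplings and volumes; no continuum-physics
claim.

# DoeblinHotMixingCeiling — THE COUPON-COLLECTOR CEILING SURVIVES A HOT LEVEL THAT IS REFRESHED ONLY WITH WEIGHT `w_E`:
# `d(n) ≤ ((2K+p)/p)·(1 − tcp/(2m))ⁿ` ONCE `4t ≤ p(1−t)w_E`, `t_mix(ε) ≤ ⌈(2m/(tcp))·log((2K+p)/(pε))⌉`; WITH PERFECT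
# TRANSPORTS `d(n) ≤ 2(K+1)·(1 − t(1−t)w_E c/(2m))ⁿ` — CHAPTER M WITH `w₀ ↦ w_E` (lean-2 GEN-27, ours)

Venture-side (OURS).  Cell `lqcd-flow` (pub-lqcd), unit `pub-lqcd-lean-2-g27`, 2026-08-27.  Doeblin-minorised hot
samplers, file 4.  THE SCHEME: hub list `e_r = (0, κ_r+1)` (`m ≥ 1` entries, every cold level listed `≥ c` times),
maps `φ_r`, positive unit-mass laws `μ_k`, Metropolis graph swap `GSw`; update step = exact hot refresh
`Ẽ_0 = coordKernel E 0` (`E_k(u,·) = μ_k`) with weight `w_E` plus `μ_k`-stationary single-site moves `M_k` with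
weights `w_k` at every level, the hub `k = 0` INCLUDED; `w_E + Σ_k w_k = 1`;
`P = t·GSw + (1−t)·(w_E·Ẽ_0 + Π_w^M)`.  One-sided domination `p·μ_{l_r}(φ_r u) ≤ μ_0(u)` (and optionally the reverse
constant `q`).

## What is proved

* §1 the point start: `pointAug_fresh`, `pointAug_fst`, `pointAug_snd`; **`refreshStar_tvDist_le_stale`** —
  `‖δ_x Pⁿ − π̃‖_TV ≤ (δ_{univ}Qⁿ){D ≠ ∅}` with `Q` chapter M's tag chain of hot weight `w_E`;
  **`refreshStar_worstTvDist_le_of_tagBound`** — any bound `C·aⁿ` on that tag mass bounds `d(n)`.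
* §2 **`refreshStar_worstTvDist_le`** (`4t ≤ p(1−t)w_E`): `d(n) ≤ ((2K+p)/p)·(1 − tcp/(2m))ⁿ`;
  `refreshStar_worstTvDist_le_of_ge_log`; **`refreshStar_mixingTime_le`**: `t_mix(ε) ≤ ⌈(2m/(tcp))·log((2K+p)/(pε))⌉`.
* §3 perfect transports (`μ_{l_r}∘φ_r = μ_0`, `0 < t < 1`, `w_E > 0`, no regime): **`refreshPerfectStar_worstTvDist_le`**
  `d(n) ≤ 2(K+1)·(1 − t(1−t)w_E c/(2m))ⁿ`; **`refreshPerfectStar_mixingTime_le`**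
  `t_mix(ε) ≤ ⌈(2m/(t(1−t)w_E c))·log(2(K+1)/ε)⌉`.

Reading (no numerics implied): only the REFRESH weight of the hot level enters, and only through the regime
`4t ≤ p(1−t)w_E` (one-sided case) or the rate `t(1−t)w_E c/(2m)` (perfect case); what the hot level does the rest
of the time is immaterial as long as it is `μ_0`-stationary.  The sequel `Scaling/DoeblinHotSampler` reads a
`μ_0`-stationary hot kernel with `M_0(u,·) ≥ a·μ_0(·)` as such a scheme with `w_E = a·w_0`.  NOT CLAIMED: a ceiling
free of the regime; anything for hot kernels without a minorisation; anything measured.  Literature grade (cell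
rule): OWN RESULT; nothing cited as a fact; no new bib keys.
-/

noncomputable section

open Finset Function
open Literature.Probability.MarkovChains

namespace Summit.Ventures.LatticeQCDFlow.Scaling

variable {S : Type*} [Fintype S] [DecidableEq S] {K m : ℕ} {μ : Fin (K + 1) → S → ℝ} {M E : Fin (K + 1) → S → S → ℝ}
  {w : Fin (K + 1) → ℝ} {t wE p q : ℝ}

section Ceiling
variable (κ : Fin m → Fin K) (φ : Fin m → Equiv.Perm S)

/-! ## §1 The point start and the tag-mass bound -/

omit [Fintype S] in
/-- The augmented point start `δ_{(x, univ)}` is fresh (no coordinate is clean). [ours] -/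
theorem pointAug_fresh (x : Fin (K + 1) → S) :
    ∀ (z : Fin (K + 1) → S) (D : Finset (Fin (K + 1))) (j : Fin (K + 1)) (v : S), j ∉ D →
      (Pi.single (x, (univ : Finset (Fin (K + 1)))) (1 : ℝ) : _ → ℝ) (update z j v, D) * μ j (z j)
        = (Pi.single (x, (univ : Finset (Fin (K + 1)))) (1 : ℝ) : _ → ℝ) (z, D) * μ j v := by
  intro z D j v hj
  have hD : D ≠ univ := fun h => hj (h ▸ mem_univ j)
  rw [Pi.single_eq_of_ne (fun h => hD (Prod.mk.inj h).2), Pi.single_eq_of_ne (fun h => hD (Prod.mk.inj h).2),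
    zero_mul, zero_mul]

/-- The configuration marginal of `δ_{(x, univ)}` is `δ_x`. [ours] -/
theorem pointAug_fst (x : Fin (K + 1) → S) :
    (fun z : Fin (K + 1) → S => ∑ D : Finset (Fin (K + 1)),
        (Pi.single (x, (univ : Finset (Fin (K + 1)))) (1 : ℝ) : _ → ℝ) (z, D)) = Pi.single x 1 := by
  funext z
  rw [← sum_filter_prodFst_eq (fun b => (Pi.single (x, (univ : Finset (Fin (K + 1)))) (1 : ℝ) : _ → ℝ) b) z]
  exact sum_filter_prodFst_single x univ z

/-- The tag marginal of `δ_{(x, univ)}` is `δ_{univ}`. [ours] -/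
theorem pointAug_snd (x : Fin (K + 1) → S) :
    (fun D : Finset (Fin (K + 1)) => ∑ z : Fin (K + 1) → S,
        (Pi.single (x, (univ : Finset (Fin (K + 1)))) (1 : ℝ) : _ → ℝ) (z, D)) = Pi.single univ 1 := by
  funext D
  rw [← sum_filter_prodSnd_eq (fun b => (Pi.single (x, (univ : Finset (Fin (K + 1)))) (1 : ℝ) : _ → ℝ) b) D]
  exact sum_filter_prodSnd_single x univ D

/-- **`‖δ_x Pⁿ − π̃‖_TV ≤ (δ_{univ}Qⁿ){D ≠ ∅}`** for the scheme with a partly refreshed hub, `Q` chapter M's tag chain run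
with hot weight `w_E` (two one-sided dominations `0 ≤ p, q ≤ 1`). [ours] -/
theorem refreshStar_tvDist_le_stale (hm : 1 ≤ m) (ht0 : 0 ≤ t) (ht1 : t ≤ 1) (hwE0 : 0 ≤ wE) (hw0 : ∀ k, 0 ≤ w k)
    (hw1 : wE + ∑ k, w k = 1) (hμ : ∀ k x, 0 < μ k x) (hμ1 : ∀ k, ∑ u, μ k u = 1) (hM : ∀ k, IsRowStochastic (M k))
    (hE : ∀ k u v, E k u v = μ k v) (hstat : ∀ (k : Fin (K + 1)) (v : S), ∑ u, μ k u * M k u v = μ k v)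
    (hp0 : 0 ≤ p) (hp1 : p ≤ 1) (hq0 : 0 ≤ q) (hq1 : q ≤ 1) (hdom : ∀ r u, p * μ (κ r).succ (φ r u) ≤ μ 0 u)
    (hrev : ∀ r u, q * μ 0 u ≤ μ (κ r).succ (φ r u))
    {gbar : Fin m → Finset (Fin (K + 1)) → ℝ}
    (hg : ∀ r D, gbar r D = if (0 : Fin (K + 1)) ∉ D then (if (κ r).succ ∉ D then (1 : ℝ) else p)
      else (if (κ r).succ ∉ D then q else 0))
    {Bset : Fin m → Finset (Fin (K + 1)) → Finset (Fin (K + 1))}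
    (hB : ∀ r D, Bset r D = if (0 : Fin (K + 1)) ∉ D ∧ (κ r).succ ∉ D then D
      else insert (0 : Fin (K + 1)) (insert (κ r).succ D))
    {Q : Finset (Fin (K + 1)) → Finset (Fin (K + 1)) → ℝ}
    (hQ : ∀ D D', Q D D' = ∑ r : Fin m, t / m *
        (gbar r D * (if D' = D.image (Equiv.swap (0 : Fin (K + 1)) (κ r).succ) then (1 : ℝ) else 0)
          + (1 - gbar r D) * (if D' = Bset r D then (1 : ℝ) else 0))
      + (1 - t) * (wE * (if D' = D.erase 0 then (1 : ℝ) else 0) + (1 - wE) * (if D' = D then (1 : ℝ) else 0)))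
    (x : Fin (K + 1) → S) (n : ℕ) :
    tvDist (lawAt (fun y z : Fin (K + 1) → S =>
          t * ptGraphSwap μ (fun r : Fin m => (((0 : Fin (K + 1)), (κ r).succ) : Fin (K + 1) × Fin (K + 1))) φ y z
          + (1 - t) * (wE * coordKernel E 0 y z + prodKernel w M y z)) (Pi.single x 1) n) (tensorFun μ)
      ≤ ∑ D ∈ univ.filter (fun D : Finset (Fin (K + 1)) => D ≠ ∅), lawAt Q (Pi.single (univ : Finset (Fin (K + 1))) 1) n D := by
  -- the hypothesis-equation objects of the augmentation
  set α : Fin m → (Fin (K + 1) → S) → ℝ :=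
    fun r z => min 1 (tensorFun μ (edgeFlowSwap (φ r) 0 (κ r).succ z) / tensorFun μ z) with hα_def
  have hα : ∀ r z, α r z = min 1 (tensorFun μ (edgeFlowSwap (φ r) 0 (κ r).succ z) / tensorFun μ z) := fun _ _ => rfl
  set β : Fin m → (Fin (K + 1) → S) → ℝ := fun r z => p * μ (κ r).succ (φ r (z 0)) / μ 0 (z 0) with hβ_def
  have hβ : ∀ r z, β r z = p * μ (κ r).succ (φ r (z 0)) / μ 0 (z 0) := fun _ _ => rfl
  set β' : Fin m → (Fin (K + 1) → S) → ℝ :=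
    fun r z => q * μ 0 ((φ r).symm (z (κ r).succ)) / μ (κ r).succ (z (κ r).succ) with hβ'_def
  have hβ' : ∀ r z, β' r z = q * μ 0 ((φ r).symm (z (κ r).succ)) / μ (κ r).succ (z (κ r).succ) := fun _ _ => rfl
  set γ : Fin m → (Fin (K + 1) → S) × Finset (Fin (K + 1)) → ℝ := fun r a =>
    if (0 : Fin (K + 1)) ∉ a.2 then (if (κ r).succ ∉ a.2 then α r a.1 else β r a.1)
    else (if (κ r).succ ∉ a.2 then β' r a.1 else 0) with hγ_def
  have hγ : ∀ r a, γ r a = if (0 : Fin (K + 1)) ∉ a.2 then (if (κ r).succ ∉ a.2 then α r a.1 else β r a.1)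
      else (if (κ r).succ ∉ a.2 then β' r a.1 else 0) := fun _ _ => rfl
  set Ph : (Fin (K + 1) → S) × Finset (Fin (K + 1)) → (Fin (K + 1) → S) × Finset (Fin (K + 1)) → ℝ := fun a b =>
    ∑ r : Fin m, t / m *
        (γ r a * (if b.1 = edgeFlowSwap (φ r) 0 (κ r).succ a.1 ∧ b.2 = a.2.image (Equiv.swap (0 : Fin (K + 1)) (κ r).succ)
            then (1 : ℝ) else 0)
          + (α r a.1 - γ r a) * (if b.1 = edgeFlowSwap (φ r) 0 (κ r).succ a.1 ∧ b.2 = Bset r a.2 then (1 : ℝ) else 0)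
          + (1 - α r a.1) * (if b.1 = a.1 ∧ b.2 = Bset r a.2 then (1 : ℝ) else 0))
      + (1 - t) * (wE * (coordKernel E 0 a.1 b.1 * (if b.2 = a.2.erase 0 then (1 : ℝ) else 0))
          + ∑ k : Fin (K + 1), w k * (coordKernel M k a.1 b.1 * (if b.2 = a.2 then (1 : ℝ) else 0))) with hPh_def
  have hPh : ∀ a b, Ph a b = ∑ r : Fin m, t / m *
        (γ r a * (if b.1 = edgeFlowSwap (φ r) 0 (κ r).succ a.1 ∧ b.2 = a.2.image (Equiv.swap (0 : Fin (K + 1)) (κ r).succ)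
            then (1 : ℝ) else 0)
          + (α r a.1 - γ r a) * (if b.1 = edgeFlowSwap (φ r) 0 (κ r).succ a.1 ∧ b.2 = Bset r a.2 then (1 : ℝ) else 0)
          + (1 - α r a.1) * (if b.1 = a.1 ∧ b.2 = Bset r a.2 then (1 : ℝ) else 0))
      + (1 - t) * (wE * (coordKernel E 0 a.1 b.1 * (if b.2 = a.2.erase 0 then (1 : ℝ) else 0))
          + ∑ k : Fin (K + 1), w k * (coordKernel M k a.1 b.1 * (if b.2 = a.2 then (1 : ℝ) else 0))) := fun _ _ => rfl
  have h := dob_tvDist_le_stale_of κ φ hm ht0 ht1 hwE0 hw0 hw1 hμ hμ1 hM hE hstat hp0 hp1 hq0 hq1 hdom hrev hα hβ hβ' hγ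
    hg hB hPh hQ (Λ₀ := (Pi.single (x, (univ : Finset (Fin (K + 1)))) (1 : ℝ) : _ → ℝ)) (pointAug_fresh x) (fun a => by
      by_cases ha : a = (x, (univ : Finset (Fin (K + 1))))
      · subst ha; rw [Pi.single_eq_same]; norm_num
      · rw [Pi.single_eq_of_ne ha])
    (by rw [Finset.sum_pi_single', if_pos (mem_univ _)]) n
  rw [pointAug_fst, pointAug_snd] at h
  exact h

/-- **ANY BOUND ON THE TAG MASS BOUNDS THE DISTANCE:** if `(δ_{univ}Qⁿ){D ≠ ∅} ≤ C·aⁿ` then `d(n) ≤ C·aⁿ`. [ours] -/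
theorem refreshStar_worstTvDist_le_of_tagBound (hm : 1 ≤ m) (ht0 : 0 ≤ t) (ht1 : t ≤ 1) (hwE0 : 0 ≤ wE)
    (hw0 : ∀ k, 0 ≤ w k) (hw1 : wE + ∑ k, w k = 1) (hμ : ∀ k x, 0 < μ k x) (hμ1 : ∀ k, ∑ u, μ k u = 1)
    (hM : ∀ k, IsRowStochastic (M k)) (hE : ∀ k u v, E k u v = μ k v)
    (hstat : ∀ (k : Fin (K + 1)) (v : S), ∑ u, μ k u * M k u v = μ k v)
    (hp0 : 0 ≤ p) (hp1 : p ≤ 1) (hq0 : 0 ≤ q) (hq1 : q ≤ 1) (hdom : ∀ r u, p * μ (κ r).succ (φ r u) ≤ μ 0 u)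
    (hrev : ∀ r u, q * μ 0 u ≤ μ (κ r).succ (φ r u))
    {gbar : Fin m → Finset (Fin (K + 1)) → ℝ}
    (hg : ∀ r D, gbar r D = if (0 : Fin (K + 1)) ∉ D then (if (κ r).succ ∉ D then (1 : ℝ) else p)
      else (if (κ r).succ ∉ D then q else 0))
    {Bset : Fin m → Finset (Fin (K + 1)) → Finset (Fin (K + 1))}
    (hB : ∀ r D, Bset r D = if (0 : Fin (K + 1)) ∉ D ∧ (κ r).succ ∉ D then D
      else insert (0 : Fin (K + 1)) (insert (κ r).succ D))
    {Q : Finset (Fin (K + 1)) → Finset (Fin (K + 1)) → ℝ}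
    (hQ : ∀ D D', Q D D' = ∑ r : Fin m, t / m *
        (gbar r D * (if D' = D.image (Equiv.swap (0 : Fin (K + 1)) (κ r).succ) then (1 : ℝ) else 0)
          + (1 - gbar r D) * (if D' = Bset r D then (1 : ℝ) else 0))
      + (1 - t) * (wE * (if D' = D.erase 0 then (1 : ℝ) else 0) + (1 - wE) * (if D' = D then (1 : ℝ) else 0)))
    {C a : ℝ} {n : ℕ}
    (htag : ∑ D ∈ univ.filter (fun D : Finset (Fin (K + 1)) => D ≠ ∅),
      lawAt Q (Pi.single (univ : Finset (Fin (K + 1))) 1) n D ≤ C * a ^ n) :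
    worstTvDist (fun y z : Fin (K + 1) → S =>
        t * ptGraphSwap μ (fun r : Fin m => (((0 : Fin (K + 1)), (κ r).succ) : Fin (K + 1) × Fin (K + 1))) φ y z
          + (1 - t) * (wE * coordKernel E 0 y z + prodKernel w M y z)) (tensorFun μ) n ≤ C * a ^ n := by
  have hwE1 : wE ≤ 1 := by
    have h := sum_nonneg fun k (_ : k ∈ (univ : Finset (Fin (K + 1)))) => hw0 k
    linarith
  have hbound : 0 ≤ C * a ^ n :=
    le_trans (sum_nonneg fun D _ => lawAt_nonneg (regen_isRowStochastic κ hm ht0 ht1 hwE0 hwE1 hp0 hp1 hq0 hq1 hg hQ)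
      (fun U => by
        by_cases h : U = univ
        · subst h; rw [Pi.single_eq_same]; norm_num
        · rw [Pi.single_eq_of_ne h]) n D) htag
  refine Real.iSup_le (fun x => ?_) hbound
  exact (refreshStar_tvDist_le_stale κ φ hm ht0 ht1 hwE0 hw0 hw1 hμ hμ1 hM hE hstat hp0 hp1 hq0 hq1 hdom hrev hg hB hQ
    x n).trans htag

/-! ## §2 One-sided domination: chapter M's ceiling with `w₀ ↦ w_E` -/

/-- **THE DISTANCE PROFILE WITH A PARTLY REFRESHED HUB:** `0 < p ≤ 1`, `p·μ_{l_r}(φ_r u) ≤ μ_0(u)`, `4t ≤ p(1−t)w_E`,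
hub multiplicities `c ≤ #{r : κ_r = p'}`, `1 ≤ c ≤ m`, exact refresh of weight `w_E`, `μ_k`-stationary moves at
every level (the hub included): **`d(n) ≤ ((2K+p)/p)·(1 − t·c·p/(2m))ⁿ`.** [ours] -/
theorem refreshStar_worstTvDist_le (hm : 1 ≤ m) (ht0 : 0 ≤ t) (ht1 : t ≤ 1) (hwE0 : 0 ≤ wE) (hw0 : ∀ k, 0 ≤ w k)
    (hw1 : wE + ∑ k, w k = 1) (hμ : ∀ k x, 0 < μ k x) (hμ1 : ∀ k, ∑ u, μ k u = 1) (hM : ∀ k, IsRowStochastic (M k))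
    (hE : ∀ k u v, E k u v = μ k v) (hstat : ∀ (k : Fin (K + 1)) (v : S), ∑ u, μ k u * M k u v = μ k v)
    (hp0 : 0 < p) (hp1 : p ≤ 1) (hdom : ∀ r u, p * μ (κ r).succ (φ r u) ≤ μ 0 u) (hreg : 4 * t ≤ p * (1 - t) * wE)
    {c : ℕ} (hc1 : 1 ≤ c) (hc : ∀ p' : Fin K, c ≤ (univ.filter (fun r : Fin m => κ r = p')).card) (hcm : c ≤ m)
    (n : ℕ) :
    worstTvDist (fun y z : Fin (K + 1) → S =>
        t * ptGraphSwap μ (fun r : Fin m => (((0 : Fin (K + 1)), (κ r).succ) : Fin (K + 1) × Fin (K + 1))) φ y z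
          + (1 - t) * (wE * coordKernel E 0 y z + prodKernel w M y z)) (tensorFun μ) n
      ≤ (2 * (K : ℝ) + p) / p * (1 - t * c * p / (2 * m)) ^ n := by
  set gbar : Fin m → Finset (Fin (K + 1)) → ℝ := fun r D =>
    if (0 : Fin (K + 1)) ∉ D then (if (κ r).succ ∉ D then (1 : ℝ) else p) else (if (κ r).succ ∉ D then (0 : ℝ) else 0)
    with hg_def
  have hg : ∀ r D, gbar r D = if (0 : Fin (K + 1)) ∉ D then (if (κ r).succ ∉ D then (1 : ℝ) else p)
      else (if (κ r).succ ∉ D then (0 : ℝ) else 0) := fun _ _ => rfl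
  set Bset : Fin m → Finset (Fin (K + 1)) → Finset (Fin (K + 1)) := fun r D =>
    if (0 : Fin (K + 1)) ∉ D ∧ (κ r).succ ∉ D then D else insert (0 : Fin (K + 1)) (insert (κ r).succ D) with hB_def
  have hB : ∀ r D, Bset r D = if (0 : Fin (K + 1)) ∉ D ∧ (κ r).succ ∉ D then D
      else insert (0 : Fin (K + 1)) (insert (κ r).succ D) := fun _ _ => rfl
  set Q : Finset (Fin (K + 1)) → Finset (Fin (K + 1)) → ℝ := fun D D' => ∑ r : Fin m, t / m *
        (gbar r D * (if D' = D.image (Equiv.swap (0 : Fin (K + 1)) (κ r).succ) then (1 : ℝ) else 0)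
          + (1 - gbar r D) * (if D' = Bset r D then (1 : ℝ) else 0))
      + (1 - t) * (wE * (if D' = D.erase 0 then (1 : ℝ) else 0) + (1 - wE) * (if D' = D then (1 : ℝ) else 0)) with hQ_def
  have hQ : ∀ D D', Q D D' = ∑ r : Fin m, t / m *
        (gbar r D * (if D' = D.image (Equiv.swap (0 : Fin (K + 1)) (κ r).succ) then (1 : ℝ) else 0)
          + (1 - gbar r D) * (if D' = Bset r D then (1 : ℝ) else 0))
      + (1 - t) * (wE * (if D' = D.erase 0 then (1 : ℝ) else 0) + (1 - wE) * (if D' = D then (1 : ℝ) else 0)) :=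
    fun _ _ => rfl
  have hwE1 : wE ≤ 1 := by
    have h := sum_nonneg fun k (_ : k ∈ (univ : Finset (Fin (K + 1)))) => hw0 k
    linarith
  exact refreshStar_worstTvDist_le_of_tagBound κ φ hm ht0 ht1 hwE0 hw0 hw1 hμ hμ1 hM hE hstat hp0.le hp1 le_rfl
    zero_le_one hdom (fun r u => by rw [zero_mul]; exact (hμ _ _).le) hg hB hQ
    (regen_nonempty_le_oneSided κ hm ht0 ht1 hwE0 hwE1 hp0 hp1 le_rfl zero_le_one hreg hg hB hQ hc1 hc hcm n)

/-- **`n ≥ (2m/(tcp))·log((2K+p)/(pε))` ⇒ `d(n) ≤ ε`** for the partly refreshed hub (`0 < t`). [ours] -/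
theorem refreshStar_worstTvDist_le_of_ge_log (hm : 1 ≤ m) (ht0 : 0 < t) (ht1 : t ≤ 1) (hwE0 : 0 ≤ wE)
    (hw0 : ∀ k, 0 ≤ w k) (hw1 : wE + ∑ k, w k = 1) (hμ : ∀ k x, 0 < μ k x) (hμ1 : ∀ k, ∑ u, μ k u = 1)
    (hM : ∀ k, IsRowStochastic (M k)) (hE : ∀ k u v, E k u v = μ k v)
    (hstat : ∀ (k : Fin (K + 1)) (v : S), ∑ u, μ k u * M k u v = μ k v)
    (hp0 : 0 < p) (hp1 : p ≤ 1) (hdom : ∀ r u, p * μ (κ r).succ (φ r u) ≤ μ 0 u) (hreg : 4 * t ≤ p * (1 - t) * wE)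
    {c : ℕ} (hc1 : 1 ≤ c) (hc : ∀ p' : Fin K, c ≤ (univ.filter (fun r : Fin m => κ r = p')).card) (hcm : c ≤ m)
    {ε : ℝ} (hε : 0 < ε) {n : ℕ} (hn : 2 * (m : ℝ) / (t * c * p) * Real.log ((2 * (K : ℝ) + p) / (p * ε)) ≤ n) :
    worstTvDist (fun y z : Fin (K + 1) → S =>
        t * ptGraphSwap μ (fun r : Fin m => (((0 : Fin (K + 1)), (κ r).succ) : Fin (K + 1) × Fin (K + 1))) φ y z
          + (1 - t) * (wE * coordKernel E 0 y z + prodKernel w M y z)) (tensorFun μ) n ≤ ε := by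
  have hmpos : (0 : ℝ) < m := Nat.cast_pos.mpr (by omega)
  have hcpos : (0 : ℝ) < c := Nat.cast_pos.mpr (by omega)
  have hcm' : (c : ℝ) ≤ m := by exact_mod_cast hcm
  refine (refreshStar_worstTvDist_le κ φ hm ht0.le ht1 hwE0 hw0 hw1 hμ hμ1 hM hE hstat hp0 hp1 hdom hreg hc1 hc hcm
    n).trans ?_
  have ha0 : 0 < t * c * p / (2 * m) := by positivity
  have ha1 : t * c * p / (2 * m) ≤ 1 := by
    rw [div_le_one (by positivity)]
    have h1 : t * c ≤ 1 * m := by nlinarith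
    nlinarith
  have hC : 0 < (2 * (K : ℝ) + p) / p := by positivity
  refine geom_le_of_ge_log ha0 ha1 hC hε ?_
  have e1 : 1 / (t * c * p / (2 * m)) = 2 * (m : ℝ) / (t * c * p) := by field_simp
  have e2 : (2 * (K : ℝ) + p) / p / ε = (2 * (K : ℝ) + p) / (p * ε) := by rw [div_div]
  rw [e1, e2]; exact hn

/-- **THE MIXING CEILING WITH A PARTLY REFRESHED HUB: `t_mix(ε) ≤ ⌈(2m/(tcp))·log((2K+p)/(pε))⌉`** once
`4t ≤ p(1−t)w_E` (`0 < t`). [ours] -/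
theorem refreshStar_mixingTime_le (hm : 1 ≤ m) (ht0 : 0 < t) (ht1 : t ≤ 1) (hwE0 : 0 ≤ wE) (hw0 : ∀ k, 0 ≤ w k)
    (hw1 : wE + ∑ k, w k = 1) (hμ : ∀ k x, 0 < μ k x) (hμ1 : ∀ k, ∑ u, μ k u = 1) (hM : ∀ k, IsRowStochastic (M k))
    (hE : ∀ k u v, E k u v = μ k v) (hstat : ∀ (k : Fin (K + 1)) (v : S), ∑ u, μ k u * M k u v = μ k v)
    (hp0 : 0 < p) (hp1 : p ≤ 1) (hdom : ∀ r u, p * μ (κ r).succ (φ r u) ≤ μ 0 u) (hreg : 4 * t ≤ p * (1 - t) * wE)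
    {c : ℕ} (hc1 : 1 ≤ c) (hc : ∀ p' : Fin K, c ≤ (univ.filter (fun r : Fin m => κ r = p')).card) (hcm : c ≤ m)
    {ε : ℝ} (hε : 0 < ε) :
    mixingTime (fun y z : Fin (K + 1) → S =>
        t * ptGraphSwap μ (fun r : Fin m => (((0 : Fin (K + 1)), (κ r).succ) : Fin (K + 1) × Fin (K + 1))) φ y z
          + (1 - t) * (wE * coordKernel E 0 y z + prodKernel w M y z)) (tensorFun μ) ε
      ≤ ⌈2 * (m : ℝ) / (t * c * p) * Real.log ((2 * (K : ℝ) + p) / (p * ε))⌉₊ :=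
  mixingTime_le _ _ (refreshStar_worstTvDist_le_of_ge_log κ φ hm ht0 ht1 hwE0 hw0 hw1 hμ hμ1 hM hE hstat hp0 hp1 hdom
    hreg hc1 hc hcm hε (Nat.le_ceil _))

/-! ## §3 Perfect transports: no regime, rate `t(1−t)w_E c/(2m)` -/

/-- **THE DISTANCE PROFILE WITH PERFECT TRANSPORTS AND A PARTLY REFRESHED HUB:** `μ_{l_r}(φ_r u) = μ_0(u)` on every hub
edge, `0 < t < 1`, `0 < w_E`: **`d(n) ≤ 2(K+1)·(1 − t(1−t)w_E c/(2m))ⁿ`.** [ours] -/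
theorem refreshPerfectStar_worstTvDist_le (hm : 1 ≤ m) (ht0 : 0 < t) (ht1 : t < 1) (hwE0 : 0 < wE)
    (hw0 : ∀ k, 0 ≤ w k) (hw1 : wE + ∑ k, w k = 1) (hμ : ∀ k x, 0 < μ k x) (hμ1 : ∀ k, ∑ u, μ k u = 1)
    (hM : ∀ k, IsRowStochastic (M k)) (hE : ∀ k u v, E k u v = μ k v)
    (hstat : ∀ (k : Fin (K + 1)) (v : S), ∑ u, μ k u * M k u v = μ k v) (hperf : ∀ r u, μ (κ r).succ (φ r u) = μ 0 u)
    {c : ℕ} (hc1 : 1 ≤ c) (hc : ∀ p' : Fin K, c ≤ (univ.filter (fun r : Fin m => κ r = p')).card) (hcm : c ≤ m)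
    (n : ℕ) :
    worstTvDist (fun y z : Fin (K + 1) → S =>
        t * ptGraphSwap μ (fun r : Fin m => (((0 : Fin (K + 1)), (κ r).succ) : Fin (K + 1) × Fin (K + 1))) φ y z
          + (1 - t) * (wE * coordKernel E 0 y z + prodKernel w M y z)) (tensorFun μ) n
      ≤ 2 * ((K : ℝ) + 1) * (1 - t * (1 - t) * wE * c / (2 * m)) ^ n := by
  set gbar : Fin m → Finset (Fin (K + 1)) → ℝ := fun r D =>
    if (0 : Fin (K + 1)) ∉ D then (if (κ r).succ ∉ D then (1 : ℝ) else (1 : ℝ))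
    else (if (κ r).succ ∉ D then (1 : ℝ) else 0) with hg_def
  have hg : ∀ r D, gbar r D = if (0 : Fin (K + 1)) ∉ D then (if (κ r).succ ∉ D then (1 : ℝ) else (1 : ℝ))
      else (if (κ r).succ ∉ D then (1 : ℝ) else 0) := fun _ _ => rfl
  set Bset : Fin m → Finset (Fin (K + 1)) → Finset (Fin (K + 1)) := fun r D =>
    if (0 : Fin (K + 1)) ∉ D ∧ (κ r).succ ∉ D then D else insert (0 : Fin (K + 1)) (insert (κ r).succ D) with hB_def
  have hB : ∀ r D, Bset r D = if (0 : Fin (K + 1)) ∉ D ∧ (κ r).succ ∉ D then D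
      else insert (0 : Fin (K + 1)) (insert (κ r).succ D) := fun _ _ => rfl
  set Q : Finset (Fin (K + 1)) → Finset (Fin (K + 1)) → ℝ := fun D D' => ∑ r : Fin m, t / m *
        (gbar r D * (if D' = D.image (Equiv.swap (0 : Fin (K + 1)) (κ r).succ) then (1 : ℝ) else 0)
          + (1 - gbar r D) * (if D' = Bset r D then (1 : ℝ) else 0))
      + (1 - t) * (wE * (if D' = D.erase 0 then (1 : ℝ) else 0) + (1 - wE) * (if D' = D then (1 : ℝ) else 0)) with hQ_def
  have hQ : ∀ D D', Q D D' = ∑ r : Fin m, t / m *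
        (gbar r D * (if D' = D.image (Equiv.swap (0 : Fin (K + 1)) (κ r).succ) then (1 : ℝ) else 0)
          + (1 - gbar r D) * (if D' = Bset r D then (1 : ℝ) else 0))
      + (1 - t) * (wE * (if D' = D.erase 0 then (1 : ℝ) else 0) + (1 - wE) * (if D' = D then (1 : ℝ) else 0)) :=
    fun _ _ => rfl
  have hwE1 : wE ≤ 1 := by
    have h := sum_nonneg fun k (_ : k ∈ (univ : Finset (Fin (K + 1)))) => hw0 k
    linarith
  have hdom : ∀ r u, (1 : ℝ) * μ (κ r).succ (φ r u) ≤ μ 0 u := fun r u => by rw [one_mul, hperf]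
  have hrev : ∀ r u, (1 : ℝ) * μ 0 u ≤ μ (κ r).succ (φ r u) := fun r u => by rw [one_mul, hperf]
  exact refreshStar_worstTvDist_le_of_tagBound κ φ hm ht0.le ht1.le hwE0.le hw0 hw1 hμ hμ1 hM hE hstat zero_le_one le_rfl
    zero_le_one le_rfl hdom hrev hg hB hQ (regen_nonempty_le_perfect κ hm ht0 ht1 hwE0 hwE1 rfl rfl hg hB hQ hc1 hc hcm n)

/-- **`n ≥ (2m/(t(1−t)w_E c))·log(2(K+1)/ε)` ⇒ `d(n) ≤ ε`** with perfect transports and a partly refreshed hub. [ours] -/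
theorem refreshPerfectStar_worstTvDist_le_of_ge_log (hm : 1 ≤ m) (ht0 : 0 < t) (ht1 : t < 1) (hwE0 : 0 < wE)
    (hw0 : ∀ k, 0 ≤ w k) (hw1 : wE + ∑ k, w k = 1) (hμ : ∀ k x, 0 < μ k x) (hμ1 : ∀ k, ∑ u, μ k u = 1)
    (hM : ∀ k, IsRowStochastic (M k)) (hE : ∀ k u v, E k u v = μ k v)
    (hstat : ∀ (k : Fin (K + 1)) (v : S), ∑ u, μ k u * M k u v = μ k v) (hperf : ∀ r u, μ (κ r).succ (φ r u) = μ 0 u)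
    {c : ℕ} (hc1 : 1 ≤ c) (hc : ∀ p' : Fin K, c ≤ (univ.filter (fun r : Fin m => κ r = p')).card) (hcm : c ≤ m)
    {ε : ℝ} (hε : 0 < ε) {n : ℕ} (hn : 2 * (m : ℝ) / (t * (1 - t) * wE * c) * Real.log (2 * ((K : ℝ) + 1) / ε) ≤ n) :
    worstTvDist (fun y z : Fin (K + 1) → S =>
        t * ptGraphSwap μ (fun r : Fin m => (((0 : Fin (K + 1)), (κ r).succ) : Fin (K + 1) × Fin (K + 1))) φ y z
          + (1 - t) * (wE * coordKernel E 0 y z + prodKernel w M y z)) (tensorFun μ) n ≤ ε := by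
  have hmpos : (0 : ℝ) < m := Nat.cast_pos.mpr (by omega)
  have hcpos : (0 : ℝ) < c := Nat.cast_pos.mpr (by omega)
  have hcm' : (c : ℝ) ≤ m := by exact_mod_cast hcm
  have h1t : 0 < 1 - t := by linarith
  have hwE1 : wE ≤ 1 := by
    have h := sum_nonneg fun k (_ : k ∈ (univ : Finset (Fin (K + 1)))) => hw0 k
    linarith
  refine (refreshPerfectStar_worstTvDist_le κ φ hm ht0 ht1 hwE0 hw0 hw1 hμ hμ1 hM hE hstat hperf hc1 hc hcm n).trans ?_
  have ha0 : 0 < t * (1 - t) * wE * c / (2 * m) := by positivity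
  have ha1 : t * (1 - t) * wE * c / (2 * m) ≤ 1 := by
    rw [div_le_one (by positivity)]
    have h1 : t * (1 - t) ≤ 1 := by nlinarith
    have h2 : t * (1 - t) * wE ≤ 1 := by nlinarith
    nlinarith
  have hC : 0 < 2 * ((K : ℝ) + 1) := by positivity
  refine geom_le_of_ge_log ha0 ha1 hC hε ?_
  have e1 : 1 / (t * (1 - t) * wE * c / (2 * m)) = 2 * (m : ℝ) / (t * (1 - t) * wE * c) := by field_simp
  rw [e1]; exact hn

/-- **THE MIXING CEILING WITH PERFECT TRANSPORTS AND A PARTLY REFRESHED HUB: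
`t_mix(ε) ≤ ⌈(2m/(t(1−t)w_E c))·log(2(K+1)/ε)⌉`.** [ours] -/
theorem refreshPerfectStar_mixingTime_le (hm : 1 ≤ m) (ht0 : 0 < t) (ht1 : t < 1) (hwE0 : 0 < wE)
    (hw0 : ∀ k, 0 ≤ w k) (hw1 : wE + ∑ k, w k = 1) (hμ : ∀ k x, 0 < μ k x) (hμ1 : ∀ k, ∑ u, μ k u = 1)
    (hM : ∀ k, IsRowStochastic (M k)) (hE : ∀ k u v, E k u v = μ k v)
    (hstat : ∀ (k : Fin (K + 1)) (v : S), ∑ u, μ k u * M k u v = μ k v) (hperf : ∀ r u, μ (κ r).succ (φ r u) = μ 0 u)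
    {c : ℕ} (hc1 : 1 ≤ c) (hc : ∀ p' : Fin K, c ≤ (univ.filter (fun r : Fin m => κ r = p')).card) (hcm : c ≤ m)
    {ε : ℝ} (hε : 0 < ε) :
    mixingTime (fun y z : Fin (K + 1) → S =>
        t * ptGraphSwap μ (fun r : Fin m => (((0 : Fin (K + 1)), (κ r).succ) : Fin (K + 1) × Fin (K + 1))) φ y z
          + (1 - t) * (wE * coordKernel E 0 y z + prodKernel w M y z)) (tensorFun μ) ε
      ≤ ⌈2 * (m : ℝ) / (t * (1 - t) * wE * c) * Real.log (2 * ((K : ℝ) + 1) / ε)⌉₊ :=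
  mixingTime_le _ _ (refreshPerfectStar_worstTvDist_le_of_ge_log κ φ hm ht0 ht1 hwE0 hw0 hw1 hμ hμ1 hM hE hstat hperf
    hc1 hc hcm hε (Nat.le_ceil _))

end Ceiling

end Summit.Ventures.LatticeQCDFlow.Scaling

end
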